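import Literature.Probability.RandomPlanarGeometry.SLEBubbles
import Literature.Probability.RandomPlanarGeometry.SLEImageLocalisationPaths
import Literature.Probability.RandomPlanarGeometry.SLEImageLocalisationCell
import Literature.Probability.RandomPlanarGeometry.SLERestrictionMartingaleExistsKappa
import Literature.Probability.Process.MartingaleLimit
import HarnessLib

/-!
# The tilted martingale identities (line `boundary-area-law`, RS5b′/T2): assembly from the products

Line `boundary-area-law` of the crux `SubseqIdentification` (stmt-CriticalPhenomena-0783), restriction
reshape (lead c4, r-c4-5), stub `stub_tiltedMartingales` = step (T2) of the tilted [LSW] Theorem 6.5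
(G. F. Lawler, O. Schramm, W. Werner, *Conformal restriction: the chordal case*, J. Amer. Math. Soc.
**16** (2003), §5 (5.1)–(5.3) and Prop. 5.3).

**Glue (sorry-free).** The registered statement `stub_tiltedMartingales` asks for a process `Y` of the
restriction-martingale specification `IsRestrictionMartingaleK κ α λ A (LpK κ A) Y`
(`α = sleBubbleExponent κ = (6 − κ)/(2κ)`, `λ = sleBubbleIntensityReal κ = (8 − 3κ)(6 − κ)/(2κ)`) such
that, for every localisation level `n`, both `Mⁿ · Y` and `((Mⁿ)² − κ Cⁿ) · Y` are martingales of the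
Brownian filtration (`Mⁿ = imgMartK κ hA hne n` the localised image driver `h_t(W_t)`,
`Cⁿ = imgClockK κ hA hne n` its clock `∫ h_t′(W_t)² dt`). We take `Y = Ȳ = YbarK κ α λ hA hne k₀`, the
bounded martingale of [LSW] Prop. 5.3 (`isRestrictionMartingaleK_YbarK`), which is at every time the
a.s. limit of the localised martingales `Lᵏ = locMartK κ α λ hA hne (k + k₀)` (`ae_tendsto_locMartK_YbarK`).
Hence the two identities for `Ȳ` follow from the same identities for every `Lᵏ`, `k + k₀ ≥ n` — the two
registered stubs `stub_tiltedProductMartingale` (Π) and `stub_tiltedBracketMartingale` (Σ) of the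
reshaped skeleton — by the bounded limit theorem for martingales
(`Literature.Probability.Process.martingale_of_tendsto_of_abs_le`: `|Mⁿ Lᵏ| ≤ N`, `|((Mⁿ)² − κCⁿ) Lᵏ| ≤ N² + κ t`).

References: [LSW] §5 (5.1)–(5.3), Prop. 5.3. No named fact is used.
-/

noncomputable section

open MeasureTheory Filter Topology Set Metric Function
open scoped NNReal ENNReal
open Literature.Probability.RandomPlanarGeometry
open Literature.Probability.Process (preWienerMeasure martingale_of_tendsto_of_abs_le)

namespace Summit.CriticalPhenomena.SAWScalingLimit.Theorems.SubseqIdentification.BoundaryAreaLaw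

/-- **(T2) from the two product identities for the localised martingales (glue).**
If for all `0 < κ ≤ 8/3`, `α = (6−κ)/(2κ)`, `λ = (8−3κ)(6−κ)/(2κ)`, every nonempty `A ∈ 𝒬*` and all
levels `n ≤ k`, the products `Mⁿ · Lᵏ` (hypothesis Π) and `((Mⁿ)² − κ Cⁿ) · Lᵏ` (hypothesis Σ) of the
localised image driver / bracket with the localised compensated restriction martingale
`Lᵏ = locMartK κ α λ hA hne k` are martingales, then the registered tilted martingale identities (T2)
hold with `Y = Ȳ` the bounded martingale of [LSW] Prop. 5.3.
[cite: LawlerSchrammWerner2003Restriction, §5 (5.1)–(5.3) and Prop. 5.3] -/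
theorem tiltedMartingales_of_products
    (hProd : ∀ (κ : ℝ≥0) (α lam : ℝ), 0 < κ → κ ≤ 8 / 3 → α = (6 - κ) / (2 * κ) →
      lam = (8 - 3 * κ) * (6 - κ) / (2 * κ) → ∀ (A : Set ℂ) (hA : IsStarHull A) (hne : A.Nonempty) (n k : ℕ), n ≤ k →
      Martingale (fun t ω => imgMartK κ hA hne n t ω * locMartK κ α lam hA hne k t ω) brownianFiltration
        preWienerMeasure)
    (hBrk : ∀ (κ : ℝ≥0) (α lam : ℝ), 0 < κ → κ ≤ 8 / 3 → α = (6 - κ) / (2 * κ) →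
      lam = (8 - 3 * κ) * (6 - κ) / (2 * κ) → ∀ (A : Set ℂ) (hA : IsStarHull A) (hne : A.Nonempty) (n k : ℕ), n ≤ k →
      Martingale (fun t ω => (imgMartK κ hA hne n t ω ^ 2 - κ * imgClockK κ hA hne n t ω) *
        locMartK κ α lam hA hne k t ω) brownianFiltration preWienerMeasure) :
    ∀ (κ : ℝ≥0), 0 < κ → κ ≤ 8 / 3 → ∀ (A : Set ℂ) (hA : IsStarHull A) (hne : A.Nonempty),
      ∃ Y : ℝ≥0 → (ℝ≥0 → ℝ) → ℝ,
        IsRestrictionMartingaleK κ (sleBubbleExponent κ) (sleBubbleIntensityReal κ) A (LpK κ A) Y ∧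
        ∀ n : ℕ, Martingale (fun t ω => imgMartK κ hA hne n t ω * Y t ω) brownianFiltration preWienerMeasure ∧
          Martingale (fun t ω => (imgMartK κ hA hne n t ω ^ 2 - κ * imgClockK κ hA hne n t ω) * Y t ω)
            brownianFiltration preWienerMeasure := by
  intro κ hκ0 hκ A hA hne
  haveI := isProbabilityMeasure_preWienerMeasure'
  obtain ⟨k₀, hk₀⟩ := exists_forall_locTimeK_pos (κ := κ) hA hne
  have hαdef : sleBubbleExponent κ = (6 - κ) / (2 * κ) := rfl
  have hlamdef : sleBubbleIntensityReal κ = (8 - 3 * κ) * (6 - κ) / (2 * κ) := rfl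
  obtain ⟨hαpos, hlam0⟩ := exponents_pos hκ hαdef hlamdef hκ0
  have hκ8 : κ ≠ 8 := by
    intro h
    have h' : ((κ : ℝ≥0) : ℝ) ≤ 8 / 3 := by exact_mod_cast hκ
    rw [h] at h'; norm_num at h'
  have hκ4 : κ ≤ 4 := hκ.trans (by rw [div_le_iff₀ (by norm_num : (0 : ℝ≥0) < 3)]; norm_num)
  -- the localised martingales `Lᵏ = locMartK (k + (k₀ + n))` converge a.s. to `Ȳ` at every time
  have hlim : ∀ n : ℕ, ∀ᵐ ω ∂preWienerMeasure, ∀ t, Tendsto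
      (fun k ↦ locMartK κ (sleBubbleExponent κ) (sleBubbleIntensityReal κ) hA hne (k + (k₀ + n)) t ω) atTop
      (𝓝 (YbarK κ (sleBubbleExponent κ) (sleBubbleIntensityReal κ) hA hne k₀ t ω)) := by
    intro n
    filter_upwards [ae_tendsto_locMartK_YbarK hκ0 hκ hαdef hlamdef hk₀] with ω hω t
    have := (tendsto_add_atTop_iff_nat n).2 (hω t)
    refine this.congr fun k ↦ ?_
    simp only [add_assoc, add_comm n k₀]
  have hL1 : ∀ k t ω, |locMartK κ (sleBubbleExponent κ) (sleBubbleIntensityReal κ) hA hne k t ω| ≤ 1 := by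
    intro k t ω
    obtain ⟨h0, h1⟩ := locMartK_mem_Icc (κ := κ) (hA := hA) (hne := hne) (n := k) hαpos hlam0 t ω
    rw [abs_of_nonneg h0]; exact h1
  have hYad := stronglyAdapted_YbarK (κ := κ) (lam := sleBubbleIntensityReal κ) (hA := hA) (hne := hne) hαpos k₀
  refine ⟨YbarK κ _ _ hA hne k₀, isRestrictionMartingaleK_YbarK hκ0 hκ hαdef hlamdef hA hne hk₀
    (hasSLETrace_of_ne_eight_holds hκ8)
    (ae_isSimpleTrace_sleTrace_of_le_four_of_hasSLETrace_fact hasSLETrace_of_ne_eight_holds hκ0 hκ4),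
    fun n ↦ ⟨?_, ?_⟩⟩
  · -- Π: `Mⁿ · Ȳ` is the bounded a.s. limit of the martingales `Mⁿ · Lᵏ`
    obtain ⟨N, hN0, hN⟩ := exists_forall_abs_imgMartK_le (κ := κ) hA hne n
    refine martingale_of_tendsto_of_abs_le
      (M := fun k t ω ↦ imgMartK κ hA hne n t ω *
        locMartK κ (sleBubbleExponent κ) (sleBubbleIntensityReal κ) hA hne (k + (k₀ + n)) t ω)
      (C := fun _ ↦ N) (fun k ↦ hProd κ _ _ hκ0 hκ hαdef hlamdef A hA hne n (k + (k₀ + n)) (by omega)) ?_ ?_ ?_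
    · intro k t ω
      rw [abs_mul]
      exact (mul_le_mul (hN t ω) (hL1 _ t ω) (abs_nonneg _) hN0).trans (mul_one _).le
    · intro t
      filter_upwards [hlim n] with ω hω
      exact (hω t).const_mul _
    · exact fun t ↦ ((stronglyAdapted_imgMartK (κ := κ) (hA := hA) (hne := hne) n) t).mul (hYad t)
  · -- Σ: `((Mⁿ)² − κ Cⁿ) · Ȳ` is the bounded a.s. limit of the martingales `((Mⁿ)² − κ Cⁿ) · Lᵏ`
    obtain ⟨N, hN0, hN⟩ := exists_forall_abs_imgMartK_le (κ := κ) hA hne n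
    have hX2 : StronglyAdapted brownianFiltration fun t ω ↦ imgMartK κ hA hne n t ω ^ 2 - κ * imgClockK κ hA hne n t ω :=
      fun t ↦ (((stronglyAdapted_imgMartK (κ := κ) (hA := hA) (hne := hne) n) t).pow 2).sub
        (((adapted_imgClockK (κ := κ) (hA := hA) (hne := hne) n) t).stronglyMeasurable.const_mul (κ : ℝ))
    have hX2b : ∀ (t : ℝ≥0) ω, |imgMartK κ hA hne n t ω ^ 2 - κ * imgClockK κ hA hne n t ω| ≤ N ^ 2 + κ * t := by
      intro t ω
      refine (abs_sub _ _).trans (add_le_add ?_ ?_)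
      · rw [abs_pow]; exact pow_le_pow_left₀ (abs_nonneg _) (hN t ω) 2
      · rw [abs_mul, NNReal.abs_eq, abs_of_nonneg (imgClockK_nonneg n t ω)]
        exact mul_le_mul_of_nonneg_left (imgClockK_le n t ω) κ.coe_nonneg
    refine martingale_of_tendsto_of_abs_le
      (M := fun k t ω ↦ (imgMartK κ hA hne n t ω ^ 2 - κ * imgClockK κ hA hne n t ω) *
        locMartK κ (sleBubbleExponent κ) (sleBubbleIntensityReal κ) hA hne (k + (k₀ + n)) t ω)
      (C := fun t ↦ N ^ 2 + κ * t) (fun k ↦ hBrk κ _ _ hκ0 hκ hαdef hlamdef A hA hne n (k + (k₀ + n)) (by omega))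
      ?_ ?_ ?_
    · intro k t ω
      rw [abs_mul]
      exact (mul_le_mul (hX2b t ω) (hL1 _ t ω) (abs_nonneg _) (by positivity)).trans (mul_one _).le
    · intro t
      filter_upwards [hlim n] with ω hω
      exact (hω t).const_mul _
    · exact fun t ↦ (hX2 t).mul (hYad t)

/-- **Registered form** of `tiltedMartingales_of_products` (reshape r-c4-5 of the line skeleton:
`stub_tiltedMartingales := stub_tiltedMartingales_of_products stub_tiltedProductMartingale stub_tiltedBracketMartingale`).
[cite: LawlerSchrammWerner2003Restriction, §5 (5.1)–(5.3) and Prop. 5.3] -/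
theorem stub_tiltedMartingales_of_products :
    (∀ (κ : ℝ≥0) (α lam : ℝ), 0 < κ → κ ≤ 8 / 3 → α = (6 - κ) / (2 * κ) →
      lam = (8 - 3 * κ) * (6 - κ) / (2 * κ) →
      ∀ (A : Set ℂ) (hA : IsStarHull A) (hne : A.Nonempty) (n k : ℕ), n ≤ k →
      Martingale (fun t ω => imgMartK κ hA hne n t ω * locMartK κ α lam hA hne k t ω) brownianFiltration
        preWienerMeasure) →
    (∀ (κ : ℝ≥0) (α lam : ℝ), 0 < κ → κ ≤ 8 / 3 → α = (6 - κ) / (2 * κ) →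
      lam = (8 - 3 * κ) * (6 - κ) / (2 * κ) →
      ∀ (A : Set ℂ) (hA : IsStarHull A) (hne : A.Nonempty) (n k : ℕ), n ≤ k →
      Martingale (fun t ω => (imgMartK κ hA hne n t ω ^ 2 - κ * imgClockK κ hA hne n t ω) * locMartK κ α lam hA hne k t ω)
        brownianFiltration preWienerMeasure) →
    ∀ (κ : ℝ≥0), 0 < κ → κ ≤ 8 / 3 → ∀ (A : Set ℂ) (hA : IsStarHull A) (hne : A.Nonempty),
      ∃ Y : ℝ≥0 → (ℝ≥0 → ℝ) → ℝ,
        IsRestrictionMartingaleK κ (sleBubbleExponent κ) (sleBubbleIntensityReal κ) A (LpK κ A) Y ∧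
        ∀ n : ℕ, Martingale (fun t ω => imgMartK κ hA hne n t ω * Y t ω) brownianFiltration preWienerMeasure ∧
          Martingale (fun t ω => (imgMartK κ hA hne n t ω ^ 2 - κ * imgClockK κ hA hne n t ω) * Y t ω)
            brownianFiltration preWienerMeasure :=
  fun hProd hBrk ↦ tiltedMartingales_of_products hProd hBrk

end Summit.CriticalPhenomena.SAWScalingLimit.Theorems.SubseqIdentification.BoundaryAreaLaw

end
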